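import Summits.ResolutionOfSingularities.ResolutionOfSingularities.Theorems.WeightedInvariantPClassMonomialIdeals

/-!
# (F-3) File C — `p`-th powers are class `0`; Frobenius and monomial ideals  [OURS · L1 W4.3]

Kernel infrastructure for RE-ENTRY OBJECT #1 of chain w43 (the DOM word at level ≤ 3,
door crux `stmt-ResolutionOfSingularities-19897`), continuing files A
(`WeightedInvariantPClassDecomposition`) and B (`WeightedInvariantPClassMonomialIdeals`).

For a commutative ring `K` of exponential characteristic `p` and `K⟦X_σ⟧`:

* `p`-TH POWERS ARE CLASS `0`: `pClassComponent p 0 (f ^ p) = f ^ p` and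
  `pClassComponent p κ (f ^ p) = 0` for `κ ≠ 0` (`pClassComponent_zero_pow_expChar`,
  `pClassComponent_pow_expChar_eq_zero`); the class components are `K⟦X^p⟧`-linear:
  `(f^p · g)_κ = f^p · g_κ` (`pClassComponent_pow_expChar_mul`);
* FROBENIUS AND IDEALS: `h ∈ (S) ⟹ h^q ∈ (s^q : s ∈ S)` in any commutative semiring of exponential
  characteristic `q` (`pow_expChar_mem_span_image`), whence
  `h ∈ (X^a : a ∈ A) ⟹ h^p ∈ (X^{p•a} : a ∈ A)` (`pow_expChar_mem_span_monomial`);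
* a class-`0` series without constant term lies in `(X_i^p : i)` (`mem_span_X_pow_of_exponentClass_eq_zero`,
  `pClassComponent_zero_mem_span_X_pow`) — the step «`G := v_0 ∈ (x^p, v'^p, y'^p) ⊆ 𝔪²`» of the
  Frobenius-class argument.

[OURS · L1 W4.3] replaces the role of the Cohen-structure / `p`-basis bookkeeping in the
Frobenius-class argument (O70B-JCAN-PLAN §7 (i), §8); NOT a statement of the manuscript.
-/

set_option linter.dupNamespace false

namespace Summit.ResolutionOfSingularities.ResolutionOfSingularities.Theorems.LocalEngine.Iota3.PClass

open MvPowerSeries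

variable {σ : Type*} {K : Type*} [CommRing K]

/-! ## Classes of variables; exponential characteristic of `K⟦X_σ⟧` -/

/-- The class of the exponent `n·ε_i` is `n` in slot `i` and `0` elsewhere. -/
theorem exponentClass_single [DecidableEq σ] (p : ℕ) (i : σ) (n : ℕ) :
    exponentClass p (Finsupp.single i n) = Pi.single i (n : ZMod p) := by
  funext j
  rw [exponentClass_apply, Finsupp.single_apply]
  by_cases h : i = j
  · subst h
    rw [if_pos rfl, Pi.single_eq_same]
  · rw [if_neg h, Pi.single_eq_of_ne (Ne.symm h), Nat.cast_zero]

/-- `K⟦X_σ⟧` has the exponential characteristic of `K` (stated as a theorem, not an instance). -/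
theorem expChar_mvPowerSeries (p : ℕ) [ExpChar K p] : ExpChar (MvPowerSeries σ K) p :=
  expChar_of_injective_ringHom MvPowerSeries.C_injective p

/-! ## `p`-th powers are class `0` -/

/-- In exponential characteristic `p`, a `p`-th power has no exponent with a coordinate not divisible
by `p` (`K` any commutative ring; the field case is `TOT2Curve.coeff_pow_prime_eq_zero`). -/
theorem coeff_pow_expChar_eq_zero (p : ℕ) [ExpChar K p] (f : MvPowerSeries σ K) {e : σ →₀ ℕ}
    {i : σ} (h : ¬ p ∣ e i) : coeff e (f ^ p) = 0 := by
  rw [← map_frobenius_expand p (expChar_ne_zero K p), coeff_map, coeff_expand_of_not_dvd p _ f h,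
    map_zero]

/-- Exponents of a `p`-th power have class `0`. -/
theorem exponentClass_eq_zero_of_coeff_pow_ne_zero (p : ℕ) [ExpChar K p] (f : MvPowerSeries σ K)
    {e : σ →₀ ℕ} (h : coeff e (f ^ p) ≠ 0) : exponentClass p e = 0 := by
  rw [exponentClass_eq_zero_iff]
  intro i
  by_contra hi
  exact h (coeff_pow_expChar_eq_zero p f hi)

/-- `p`-TH POWERS ARE CLASS `0`: the class-`0` component of `f ^ p` is `f ^ p`. -/
theorem pClassComponent_zero_pow_expChar (p : ℕ) [ExpChar K p] (f : MvPowerSeries σ K) :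
    pClassComponent p 0 (f ^ p) = f ^ p :=
  pClassComponent_eq_self fun _ he => exponentClass_eq_zero_of_coeff_pow_ne_zero p f he

/-- `p`-th powers have no component of class `κ ≠ 0`. -/
theorem pClassComponent_pow_expChar_eq_zero (p : ℕ) [ExpChar K p] {κ : σ → ZMod p} (hκ : κ ≠ 0)
    (f : MvPowerSeries σ K) : pClassComponent p κ (f ^ p) = 0 := by
  refine pClassComponent_eq_zero fun e he => ?_
  by_contra hne
  exact hκ (he.symm.trans (exponentClass_eq_zero_of_coeff_pow_ne_zero p f hne))

/-- `(p·m)`-th powers are class `0`. -/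
theorem pClassComponent_zero_pow_mul (p : ℕ) [ExpChar K p] (f : MvPowerSeries σ K) (m : ℕ) :
    pClassComponent p 0 (f ^ (p * m)) = f ^ (p * m) := by
  rw [mul_comm, pow_mul]
  exact pClassComponent_zero_pow_expChar p (f ^ m)

/-- The class components are `K⟦X^p⟧`-LINEAR: `(f^p · g)_κ = f^p · g_κ` (finitely many variables). -/
theorem pClassComponent_pow_expChar_mul [Fintype σ] [DecidableEq σ] (p : ℕ) [ExpChar K p]
    (κ : σ → ZMod p) (f g : MvPowerSeries σ K) :
    pClassComponent p κ (f ^ p * g) = f ^ p * pClassComponent p κ g := by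
  haveI : NeZero p := ⟨expChar_ne_zero K p⟩
  rw [pClassComponent_mul,
    Finset.sum_eq_single (0 : σ → ZMod p) (fun κ₁ _ hne => by
      rw [pClassComponent_pow_expChar_eq_zero p hne, zero_mul]) (fun h => absurd (Finset.mem_univ _) h),
    pClassComponent_zero_pow_expChar, sub_zero]

/-- Symmetric form: `(g · f^p)_κ = g_κ · f^p`. -/
theorem pClassComponent_mul_pow_expChar [Fintype σ] [DecidableEq σ] (p : ℕ) [ExpChar K p]
    (κ : σ → ZMod p) (f g : MvPowerSeries σ K) :
    pClassComponent p κ (g * f ^ p) = pClassComponent p κ g * f ^ p := by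
  rw [mul_comm, pClassComponent_pow_expChar_mul, mul_comm]

/-! ## Frobenius and ideals -/

/-- Frobenius pushes ideal membership to `q`-th powers of the generators
(any commutative semiring of exponential characteristic `q`). -/
theorem pow_expChar_mem_span_image {R : Type*} [CommSemiring R] (q : ℕ) [ExpChar R q] {S : Set R}
    {h : R} (hh : h ∈ Ideal.span S) : h ^ q ∈ Ideal.span ((fun s => s ^ q) '' S) := by
  have h1 : frobenius R q h ∈ (Ideal.span S).map (frobenius R q) := Ideal.mem_map_of_mem _ hh
  have h2 : (⇑(frobenius R q)) '' S = (fun s => s ^ q) '' S :=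
    Set.image_congr fun s _ => by rw [frobenius_def]
  rw [Ideal.map_span, h2, frobenius_def] at h1
  exact h1

/-- Iterated form: `h ∈ (S) ⟹ h^(q^n) ∈ (s^(q^n) : s ∈ S)`. -/
theorem pow_expChar_pow_mem_span_image {R : Type*} [CommSemiring R] (q : ℕ) [ExpChar R q] (n : ℕ)
    {S : Set R} {h : R} (hh : h ∈ Ideal.span S) :
    h ^ q ^ n ∈ Ideal.span ((fun s => s ^ q ^ n) '' S) := by
  have h1 : iterateFrobenius R q n h ∈ (Ideal.span S).map (iterateFrobenius R q n) :=
    Ideal.mem_map_of_mem _ hh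
  have h2 : (⇑(iterateFrobenius R q n)) '' S = (fun s => s ^ q ^ n) '' S :=
    Set.image_congr fun s _ => by rw [iterateFrobenius_def]
  rw [Ideal.map_span, h2, iterateFrobenius_def] at h1
  exact h1

/-- In `K⟦X_σ⟧` of exponential characteristic `p`: `h ∈ (X^a : a ∈ A) ⟹ h^p ∈ (X^{p•a} : a ∈ A)`. -/
theorem pow_expChar_mem_span_monomial (p : ℕ) [ExpChar K p] {A : Set (σ →₀ ℕ)}
    {h : MvPowerSeries σ K} (hh : h ∈ Ideal.span ((fun a => monomial a (1 : K)) '' A)) :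
    h ^ p ∈ Ideal.span ((fun a => monomial (p • a) (1 : K)) '' A) := by
  haveI := expChar_mvPowerSeries (σ := σ) (K := K) p
  have h1 := pow_expChar_mem_span_image p hh
  have h2 : ((fun s : MvPowerSeries σ K => s ^ p) ∘ fun a : σ →₀ ℕ => monomial a (1 : K)) =
      fun a => monomial (p • a) (1 : K) :=
    funext fun a => by simp only [Function.comp_apply, monomial_pow, one_pow]
  rw [← Set.image_comp, h2] at h1
  exact h1

/-! ## Class-`0` series without constant term lie in `(X_i^p : i)` -/

/-- A series all of whose exponents have class `0` and whose constant term vanishes lies in the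
ideal `(X_i^p : i ∈ σ)` (finitely many variables). -/
theorem mem_span_X_pow_of_exponentClass_eq_zero [Fintype σ] [DecidableEq σ] {p : ℕ}
    {f : MvPowerSeries σ K} (hf : ∀ e, coeff e f ≠ 0 → exponentClass p e = 0)
    (h0 : constantCoeff f = 0) :
    f ∈ Ideal.span (Set.range fun i : σ => (X i : MvPowerSeries σ K) ^ p) := by
  have hmem : f ∈ Ideal.span ((fun a => monomial a (1 : K)) ''
      (↑(Finset.image (fun i : σ => Finsupp.single i p) Finset.univ) : Set (σ →₀ ℕ))) := by
    refine mem_span_monomial_of_coeff _ fun n hn => ?_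
    have hn0 : n ≠ 0 := by
      rintro rfl
      exact hn (by rw [coeff_zero_eq_constantCoeff_apply, h0])
    obtain ⟨i, hi⟩ : ∃ i, n i ≠ 0 := by
      by_contra hc
      push Not at hc
      exact hn0 (Finsupp.ext hc)
    have hcl := hf n hn
    rw [exponentClass_eq_zero_iff] at hcl
    refine ⟨Finsupp.single i p, Finset.mem_image_of_mem _ (Finset.mem_univ i), ?_⟩
    rw [Finsupp.single_le_iff]
    exact Nat.le_of_dvd (Nat.pos_of_ne_zero hi) (hcl i)
  refine (Ideal.span_le.mpr ?_) hmem
  rintro _ ⟨a, ha, rfl⟩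
  obtain ⟨i, -, rfl⟩ := Finset.mem_image.mp (Finset.mem_coe.mp ha)
  exact Ideal.subset_span ⟨i, X_pow_eq i p⟩

/-- The class-`0` component of a series without constant term lies in `(X_i^p : i ∈ σ)`
(the step «`v_0 ∈ (x^p, v'^p, y'^p)`» of the Frobenius-class argument). -/
theorem pClassComponent_zero_mem_span_X_pow [Fintype σ] [DecidableEq σ] (p : ℕ)
    {f : MvPowerSeries σ K} (h0 : constantCoeff f = 0) :
    pClassComponent p 0 f ∈ Ideal.span (Set.range fun i : σ => (X i : MvPowerSeries σ K) ^ p) := by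
  refine mem_span_X_pow_of_exponentClass_eq_zero (fun e he => ?_) ?_
  · by_contra hne
    exact he (coeff_pClassComponent_of_ne hne f)
  · rw [← coeff_zero_eq_constantCoeff_apply, coeff_pClassComponent_of_eq (exponentClass_zero p),
      coeff_zero_eq_constantCoeff_apply, h0]

/-- A `p`-th power without constant term lies in `(X_i^p : i ∈ σ)`. -/
theorem pow_expChar_mem_span_X_pow [Fintype σ] [DecidableEq σ] (p : ℕ) [ExpChar K p]
    {f : MvPowerSeries σ K} (h0 : constantCoeff f = 0) :
    f ^ p ∈ Ideal.span (Set.range fun i : σ => (X i : MvPowerSeries σ K) ^ p) := by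
  have h := pClassComponent_zero_mem_span_X_pow p (f := f ^ p)
    (by rw [map_pow, h0, zero_pow (expChar_ne_zero K p)])
  rwa [pClassComponent_zero_pow_expChar] at h

/-- The ideal `(X_i^p : i)` is contained in the `p`-th power of the ideal of the variables `(X_i : i)`. -/
theorem span_X_pow_le_span_X_pow (p : ℕ) :
    Ideal.span (Set.range fun i : σ => (X i : MvPowerSeries σ K) ^ p) ≤
      (Ideal.span (Set.range fun i : σ => (X i : MvPowerSeries σ K))) ^ p := by
  rw [Ideal.span_le]
  rintro _ ⟨i, rfl⟩
  have hi : (X i : MvPowerSeries σ K) ∈ Ideal.span (Set.range fun i : σ => (X i : MvPowerSeries σ K)) :=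
    Ideal.subset_span ⟨i, rfl⟩
  exact Ideal.pow_mem_pow hi p

end Summit.ResolutionOfSingularities.ResolutionOfSingularities.Theorems.LocalEngine.Iota3.PClass
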